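import Literature.Probability.RandomPlanarGeometry.SAWStripTMInvJoin2
import HarnessLib

/-!
# The invariant of the enriched strip transfer matrix, VI: `joinH` joins two strands; the step (soundness, part 10)

Topic `Literature/Probability/RandomPlanarGeometry` (soundness of `SAWStripTM.lean`, part 10;
continues `SAWStripTMInvJoin2.lean`): the `stop`/`stop` case of `joinH` (two different strands
are joined through the horizontal edge, their far ends retargeted to each other), the dispatcher
`inv_joinH`, and **`inv_step`**: every micro-step that continues the run preserves `Inv`.

## References

* I. Jensen, J. Phys. A 37 (2004) 11521–11529, §2.1.
* D. E. Knuth, TAOCP 4A (2011), §7.1.4.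
-/

namespace Literature.Probability.RandomPlanarGeometry.SAW

namespace StripTM

variable {l r0 : ℕ} {cs : List Bool} {u : ℕ} {σ σ' : State} {S : List (List XCell)}

/-! ### `stop` / `stop` -/

/-- `joinH`, case `stop`/`stop`/edge. [folklore] -/
theorem joinH_stop_stop {t : ℕ} {σ : State} (hc : t % l ≠ 0) {ma mb : Mate}
    (ha : σ.slots[t % l - 1]? = some (Code.stop ma)) (hb : σ.slots[t % l]? = some (Code.stop mb)) :
    joinH l t σ true =
      if ma = .col (t % l) ∨ mb = .col (t % l - 1) then .dead
      else if (ma = .src ∧ mb = .snk) ∨ (ma = .snk ∧ mb = .src) then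
        completeIf (othersClosed σ.slots [t % l - 1, t % l]) (bump σ.gaps (t % l - 1))
      else .next { σ with
        slots := retarget (retarget ((σ.slots.set (t % l - 1) .inter).set (t % l) .inter) ma mb) mb ma
        gaps := bump σ.gaps (t % l - 1) } := by
  simp only [joinH, hc, ha, hb, Option.getD_some]
  rfl

/-- `gJoinH`, case `stop`/`stop`/edge. [folklore] -/
theorem gJoinH_stop_stop {t : ℕ} {σ : State} (S : List (List XCell)) {ma mb : Mate}
    (ha : σ.slots[t % l - 1]? = some (Code.stop ma)) (hb : σ.slots[t % l]? = some (Code.stop mb)) :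
    gJoinH l t σ S true = merge S (leftOf l t) (cellOf l t) := by
  simp [gJoinH, ha, hb]

/-- A mate that denotes a frontier cell is that column. [folklore] -/
theorem mate_eq_col_of_mateCell_eq_front {u : ℕ} {m : Mate} {k : ℕ} (h : mateCell l u m = front l u k) :
    m = .col k := by
  cases m with
  | col j => simp only [mateCell] at h; rw [front_inj h]
  | src => obtain ⟨r, hr⟩ := front_eq_cell (l := l) u k; rw [hr] at h; simp [mateCell] at h
  | snk => obtain ⟨r, hr⟩ := front_eq_cell (l := l) u k; rw [hr] at h; simp [mateCell] at h

/-- **Case `stop`/`stop`/edge of `joinH`**: two different strands are joined through the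
horizontal edge; their far ends are retargeted to each other. [cite: Jensen2004SAWLowerBounds, §2.1] -/
theorem inv_joinH_stop_stop (hl : 2 ≤ l) (hu : u % 2 = 1) (hI : Inv l r0 cs u σ S)
    (hc1 : 1 ≤ u / 2 % l) {ma mb : Mate} (ha : σ.slots[u / 2 % l - 1]? = some (Code.stop ma))
    (hb : σ.slots[u / 2 % l]? = some (Code.stop mb)) (hcs : cs.getD u false = true)
    (hnd : ¬ (ma = .col (u / 2 % l) ∨ mb = .col (u / 2 % l - 1)))
    (he : joinH l (u / 2) σ true = .next σ') :
    Inv l r0 cs (u + 1) σ' (gJoinH l (u / 2) σ S true) := by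
  have hl0 : 0 < l := by omega
  have hc : u / 2 % l < l := Nat.mod_lt _ hl0
  have hcm : u / 2 % l - 1 < l := by omega
  have hcs' : u / 2 % l < σ.slots.length := by rw [hI.len_slots]; exact hc
  have hcm' : u / 2 % l - 1 < σ.slots.length := by rw [hI.len_slots]; exact hcm
  have hne : u / 2 % l - 1 ≠ u / 2 % l := by omega
  rw [joinH_stop_stop (by omega) ha hb, if_neg hnd] at he
  by_cases hcomp : (ma = .src ∧ mb = .snk) ∨ (ma = .snk ∧ mb = .src)
  · exfalso; rw [if_pos hcomp, completeIf] at he; revert he; split_ifs <;> simp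
  rw [if_neg hcomp] at he
  have hsl : σ'.slots = retarget (retarget ((σ.slots.set (u / 2 % l - 1) .inter).set (u / 2 % l) .inter)
      ma mb) mb ma := by cases he; rfl
  have hga : σ'.gaps = bump σ.gaps (u / 2 % l - 1) := by cases he; rfl
  have hsi : σ'.sink = σ.sink := by cases he; rfl
  rw [gJoinH_stop_stop S ha hb]
  push Not at hnd
  obtain ⟨hma_c, hmb_cm⟩ := hnd
  have hvf : cellOf l (u / 2) = front l u (u / 2 % l) := cellOf_eq_front hu
  have hlf : leftOf l (u / 2) = front l u (u / 2 % l - 1) := leftOf_eq_front hu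
  have hA := adj_symm l r0
  have hlreal : (leftOf l (u / 2)).IsReal := by simp [leftOf, XCell.IsReal]
  have hvreal : (cellOf l (u / 2)).IsReal := by simp [cellOf, XCell.IsReal]
  have hlb : (leftOf l (u / 2), mateCell l u ma) ∈ endPairs S := (hI.ends _ _ hlreal).2 ⟨_, hcm, ma, ha, hlf, rfl⟩
  have hvb : (cellOf l (u / 2), mateCell l u mb) ∈ endPairs S := (hI.ends _ _ hvreal).2 ⟨_, hc, mb, hb, hvf, rfl⟩
  have hfar : mateCell l u ma ≠ cellOf l (u / 2) := by
    intro e; rw [hvf] at e; exact hma_c (mate_eq_col_of_mateCell_eq_front e)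
  obtain ⟨hW2, h2le2, hcells2, hpairs2, hends2⟩ :=
    join_spec hI.wf hA hI.two_le hlb hvb (leftOf_ne_cellOf hc1) hfar hlreal hvreal (adj_leftOf_cellOf hc1)
  have hbl_ne : mateCell l u ma ≠ leftOf l (u / 2) := (ne_of_mem_endPairs' hI.wf hI.two_le hlb).symm
  have hbv_ne : mateCell l u mb ≠ cellOf l (u / 2) := (ne_of_mem_endPairs' hI.wf hI.two_le hvb).symm
  have hbl_mem : mateCell l u ma ∈ cells S := mem_cells_of_mem_endPairs (endPairs_symm hlb)
  have hbv_mem : mateCell l u mb ∈ cells S := mem_cells_of_mem_endPairs (endPairs_symm hvb)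
  have hma_lt : ∀ j, ma = .col j → j < l := fun j hj => hI.mate_lt _ j (hj ▸ ha)
  have hmb_lt : ∀ j, mb = .col j → j < l := fun j hj => hI.mate_lt _ j (hj ▸ hb)
  have hma_cm : ∀ j, ma = .col j → j ≠ u / 2 % l - 1 := by
    intro j hj e; subst hj; subst e; exact hbl_ne (by simp only [mateCell]; exact hlf.symm)
  have hmb_c : ∀ j, mb = .col j → j ≠ u / 2 % l := by
    intro j hj e; subst hj; subst e; exact hbv_ne (by simp only [mateCell]; exact hvf.symm)
  -- the two far ends differ
  have hblbv : mateCell l u ma ≠ mateCell l u mb := by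
    intro e
    have h1 := endPairs_symm hlb; have h2 := endPairs_symm hvb
    rw [e] at h1
    exact leftOf_ne_cellOf hc1 (hI.wf.endPairs_unique h1 h2)
  have hjj : ∀ k, mb = .col k → ma ≠ .col k := by
    intro k hk e; apply hblbv; rw [e, hk]
  have hlook : ∀ k, σ'.slots[k]? = if mb = .col k then some (Code.stop ma)
      else if ma = .col k then some (Code.stop mb)
      else if k = u / 2 % l then some Code.inter
      else if k = u / 2 % l - 1 then some Code.inter else σ.slots[k]? := by
    intro k
    rw [hsl, getElem?_retarget]
    have inner : (retarget ((σ.slots.set (u / 2 % l - 1) .inter).set (u / 2 % l) .inter) ma mb)[k]? =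
        if ma = .col k then some (Code.stop mb) else if k = u / 2 % l then some Code.inter
        else if k = u / 2 % l - 1 then some Code.inter else σ.slots[k]? := by
      rw [getElem?_retarget]
      cases ma with
      | col j =>
        simp only [Mate.col.injEq, List.length_set]
        by_cases hjk : j = k
        · subst hjk; rw [if_pos rfl, if_pos rfl, if_pos (by rw [hI.len_slots]; exact hma_lt j rfl)]
        · rw [if_neg hjk, if_neg hjk, getElem?_set_set hcm' hcs' hne]
      | src => simp only [reduceCtorEq, if_false]; rw [getElem?_set_set hcm' hcs' hne]
      | snk => simp only [reduceCtorEq, if_false]; rw [getElem?_set_set hcm' hcs' hne]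
    cases hmb' : mb with
    | col j' =>
      simp only [Mate.col.injEq, length_retarget, List.length_set]
      by_cases hjk : j' = k
      · subst hjk; rw [if_pos rfl, if_pos rfl, if_pos (by rw [hI.len_slots]; exact hmb_lt j' hmb')]
      · rw [if_neg hjk, if_neg hjk, ← hmb', inner]
    | src => simp only [reduceCtorEq, if_false]; rw [← hmb', inner]
    | snk => simp only [reduceCtorEq, if_false]; rw [← hmb', inner]
  refine ⟨?_, ?_, ?_, hW2, h2le2, ?_, ?_, ?_, ?_, ?_, ?_, ?_, ?_⟩
  · rw [hsl, length_retarget, length_retarget, List.length_set, List.length_set, hI.len_slots]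
  · rw [hga, length_bump, hI.len_gaps]
  · intro k j h
    rw [hlook] at h
    split_ifs at h with h1 h2 h3 h4
    · cases h; exact hma_lt j rfl
    · cases h; exact hmb_lt j rfl
    · cases h
    · cases h
    · exact hI.mate_lt k j h
  · intro x hx; rw [hcells2] at hx; exact (processed_succ_odd hu _).2 (hI.processed x hx)
  · intro a b ha'
    rw [hends2]
    constructor
    · rintro (⟨hab, hne1, hne2, hne3, hne4⟩ | ⟨rfl, rfl⟩ | ⟨rfl, rfl⟩)
      · obtain ⟨k, hk, m, hkm, rfl, rfl⟩ := (hI.ends_reindex_odd hu ha').1 hab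
        refine ⟨k, hk, m, ?_, rfl, rfl⟩
        rw [hlook, if_neg, if_neg, if_neg, if_neg]; exact hkm
        · rintro rfl; exact hne1 (by rw [hlf, front_succ_odd hu hk])
        · rintro rfl; exact hne3 (by rw [hvf, front_succ_odd hu hk])
        · intro e; apply hne2; rw [e]; simp only [mateCell]; rw [front_succ_odd hu hk]
        · intro e; apply hne4; rw [e]; simp only [mateCell]; rw [front_succ_odd hu hk]
      · -- (far end of the left cell, far end of the current cell)
        cases hma' : ma with
        | col j =>
          rw [hma'] at hma_lt hjj
          refine ⟨j, hma_lt j rfl, mb, ?_, ?_, (mateCell_succ_odd hu hmb_lt).symm⟩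
          · rw [hlook, if_neg (fun e => hjj j e rfl), if_pos hma']
          · simp only [mateCell]; rw [front_succ_odd hu (hma_lt j rfl)]
        | src => rw [hma'] at ha'; exact absurd ha' (by simp [mateCell, XCell.IsReal])
        | snk => rw [hma'] at ha'; exact absurd ha' (by simp [mateCell, XCell.IsReal])
      · cases hmb' : mb with
        | col j' =>
          rw [hmb'] at hmb_lt
          refine ⟨j', hmb_lt j' rfl, ma, by rw [hlook, if_pos hmb'], ?_, (mateCell_succ_odd hu hma_lt).symm⟩
          simp only [mateCell]; rw [front_succ_odd hu (hmb_lt j' rfl)]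
        | src => rw [hmb'] at ha'; exact absurd ha' (by simp [mateCell, XCell.IsReal])
        | snk => rw [hmb'] at ha'; exact absurd ha' (by simp [mateCell, XCell.IsReal])
    · rintro ⟨k, hk, m, hkm, rfl, rfl⟩
      rw [hlook] at hkm
      split_ifs at hkm with h1 h2 h3 h4
      · cases hkm
        right; right
        refine ⟨?_, mateCell_succ_odd hu hma_lt⟩
        rw [h1]; simp only [mateCell]; rw [front_succ_odd hu hk]
      · cases hkm
        right; left
        refine ⟨?_, mateCell_succ_odd hu hmb_lt⟩
        rw [h2]; simp only [mateCell]; rw [front_succ_odd hu hk]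
      · cases hkm
      · cases hkm
      · left
        refine ⟨(hI.ends_reindex_odd hu ha').2 ⟨k, hk, m, hkm, rfl, rfl⟩, ?_, ?_, ?_, ?_⟩
        · rw [front_succ_odd hu hk, hlf]; intro e; exact h4 (front_inj e)
        · rw [front_succ_odd hu hk]; intro e; exact h2 (mate_eq_col_of_mateCell_eq_front e.symm)
        · rw [front_succ_odd hu hk, hvf]; intro e; exact h3 (front_inj e)
        · rw [front_succ_odd hu hk]; intro e; exact h1 (mate_eq_col_of_mateCell_eq_front e.symm)
  · intro k hk hk'
    rw [hlook] at hk'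
    split_ifs at hk' with h1 h2 h3 h4
    · cases hk'
    · cases hk'
    · cases hk'
    · cases hk'
    · rw [front_succ_odd hu hk, hcells2]; exact hI.empty k hk hk'
  · intro k hk c' hk'
    rw [front_succ_odd hu hk] at hk'
    rw [hlook]
    split_ifs with h1 h2 h3 h4
    · exfalso
      have : front l u k ∈ cells S := by rw [h1] at hbv_mem; simpa only [mateCell] using hbv_mem
      have := hI.processed _ this; rw [hk'] at this; exact absurd this.1 (by omega)
    · exfalso
      have : front l u k ∈ cells S := by rw [h2] at hbl_mem; simpa only [mateCell] using hbl_mem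
      have := hI.processed _ this; rw [hk'] at this; exact absurd this.1 (by omega)
    · exfalso; subst h3; rw [← hvf, cellOf] at hk'; cases hk'
    · exfalso; subst h4; rw [← hlf, leftOf] at hk'; cases hk'
    · exact hI.dummy k hk c' hk'
  · rw [hcells2, hI.vsrc_mem, src_time_succ_odd hu]
  · rw [hcells2, hsi]; exact hI.vsnk_mem
  · intro p
    rw [hpairs2, Nat.exists_lt_succ_right, potEdge_of_odd hu, hcs, Finset.mem_insert]
    simp only [true_and]
    constructor
    · rintro ⟨rfl | hp, hreal⟩
      · exact Or.inr rfl
      · exact Or.inl ((hI.pairs_iff p).1 ⟨hp, hreal⟩)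
    · rintro (h | rfl)
      · obtain ⟨hp, hreal⟩ := (hI.pairs_iff p).2 h; exact ⟨Or.inr hp, hreal⟩
      · exact ⟨Or.inl rfl, Sym2.ball.2 ⟨hlreal, hvreal⟩⟩
  · intro k hk
    rw [hga, getElem?_bump, hcount_succ_of_odd hu, hcs, hI.gaps_eq k hk]
    by_cases hk1 : u / 2 % l - 1 = k
    · rw [if_pos hk1, if_pos ⟨by omega, rfl⟩]; simp only [Option.map_some]; congr 1; omega
    · rw [if_neg hk1, if_neg (by rintro ⟨h, -⟩; omega)]; rfl

/-! ### The dispatchers -/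

/-- **`joinH` preserves the invariant** (all cases that continue the run).
[cite: Jensen2004SAWLowerBounds, §2.1] -/
theorem inv_joinH (hl : 2 ≤ l) (hu : u % 2 = 1) (hI : Inv l r0 cs u σ S)
    (he : joinH l (u / 2) σ (cs.getD u false) = .next σ') :
    Inv l r0 cs (u + 1) σ' (gJoinH l (u / 2) σ S (cs.getD u false)) := by
  have hl0 : 0 < l := by omega
  have hc : u / 2 % l < l := Nat.mod_lt _ hl0
  rcases Bool.eq_false_or_eq_true (cs.getD u false) with hcs | hcs <;> rw [hcs] at he ⊢
  swap
  · exact inv_joinH_false hu hI hcs he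
  by_cases hc0 : u / 2 % l = 0
  · exfalso; simp [joinH, hc0] at he
  have hc1 : 1 ≤ u / 2 % l := Nat.pos_of_ne_zero hc0
  have hcs' : u / 2 % l < σ.slots.length := by rw [hI.len_slots]; exact hc
  have hcm' : u / 2 % l - 1 < σ.slots.length := by rw [hI.len_slots]; omega
  obtain ⟨a, ha⟩ : ∃ a, σ.slots[u / 2 % l - 1]? = some a := ⟨_, List.getElem?_eq_getElem hcm'⟩
  obtain ⟨b, hb⟩ : ∃ b, σ.slots[u / 2 % l]? = some b := ⟨_, List.getElem?_eq_getElem hcs'⟩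
  cases a with
  | inter => exfalso; simp [joinH, hc0, ha] at he
  | empty =>
    cases b with
    | inter => exfalso; simp [joinH, hc0, ha, hb] at he
    | empty => exact inv_joinH_empty_empty hl hu hI hc1 ha hb hcs he
    | stop mb => exact inv_joinH_empty_stop hl hu hI hc1 ha hb hcs he
  | stop ma =>
    cases b with
    | inter => exfalso; simp [joinH, hc0, ha, hb] at he
    | empty => exact inv_joinH_stop_empty hl hu hI hc1 ha hb hcs he
    | stop mb =>
      by_cases hnd : ma = .col (u / 2 % l) ∨ mb = .col (u / 2 % l - 1)
      · exfalso; rw [joinH_stop_stop hc0 ha hb, if_pos hnd] at he; cases he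
      · exact inv_joinH_stop_stop hl hu hI hc1 ha hb hcs hnd he

/-- **Every micro-step that continues the run preserves the invariant.** [cite: Jensen2004SAWLowerBounds, §2.1] -/
theorem inv_step (hl : 2 ≤ l) (hI : Inv l r0 cs u σ S)
    (he : step l r0 u σ (cs.getD u false) = .next σ') :
    Inv l r0 cs (u + 1) σ' (gstep l r0 u σ S (cs.getD u false)) := by
  unfold step at he; unfold gstep
  by_cases hu : u % 2 = 0
  · rw [if_pos hu] at he ⊢; exact inv_advance hl hu hI he
  · rw [if_neg hu] at he ⊢; exact inv_joinH hl (by omega) hI he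

end StripTM

end Literature.Probability.RandomPlanarGeometry.SAW
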